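import Summits.QuantumFields.BalabanUV.T4Continuum.Support.NE7SkewTorusForms
import Summits.QuantumFields.BalabanUV.T4Continuum.Support.NE7RestrictedOperator
import Summits.QuantumFields.BalabanUV.T4Continuum.Support.NE7TensionKernelPerturbed
import Summits.QuantumFields.BalabanUV.T4Continuum.Support.NE7ExactCurrentQbarKernel
import Summits.QuantumFields.BalabanUV.T4Continuum.Support.NE7CombLineSumDivergence
import Summits.QuantumFields.BalabanUV.T4Continuum.Support.NE7TensionKernelCoercivity
import HarnessLib

/-!
# NE7TensionEnergyEnd — THE ENERGY ROAD ASSEMBLED MODULO ONE NAMED OPERATOR: the Yang–Mills tension energy of an INTERIOR `(j+2)`-level constrained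
# minimiser is `≤ 13·‖S′T̃‖²∕λ′ + (7(Λ′+δ)²∕λ′ + 4)·θ₀²` as soon as SOME continuous linear map `Sq` on the skew torus 1-forms is `δ`-close
# (`8δ ≤ √λ′`) to the restricted comb line sum and has its kernel inside `ker QbarIter L (j+2) U` — all other inputs are accepted tree theorems

Cell `pub-balaban`, rung (B)+1 sub-cell t4, lineage `b2b-balaban-t4-ne7-p1`, generation 63 (CRUX PROVER NE7 #1, ruling e34b3e0c (2)); hunt (h7)
«ENERGY ROAD» (memos `t4/b2b-balaban-t4-ne7-p1-g6{1,2}/HUNT-H7-ENERGY-ROAD*.md`).  THE ASSEMBLY (every arrow BY NAME): on the skew torus 1-forms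
`K_f ≤ Form d n (M·N)`, `K_c ≤ Form d n N` (`NE7SkewTorusForms.exists_skewForms`, `M = L^{j+2}`) take `E := K_f`, `F := K_c` in (E3‴)
`NE7TensionKernelPerturbed.normSq_le_of_exact_annihilator_near` with: `T :=` the `resF` tension datum (skew: `resF_tensionDatum_mem`);
`τ :=` the exact current of `NE7ExactCurrent` restricted to `K_f` (`θ₀ = 12·#Plane·a²·√(d·(MN)^d·card n)`-close to `⟪·,T⟫` there:
`exactCurrent_sub_tension_pairing_le` + `NE7TensionKernelCoercivity.inner_resF_tension`); `S′ :=` the restriction (`NE7RestrictedOperator`) of the comb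
line sum CLM (`NE7CombLineSumCoercive`: `λ′ = M^{d−1}M(M²+2)∕3 ≤ S′†S′… ≤ Λ′² = M^{d−1}M³`, transferred by `adjoint_restrict_lower∕upper` and
`NE7SkewTorusForms.adjoint_combLineSum_mem`); `S := Sq`, ANY CLM `K_f →L K_c` with `ker Sq ⊆ {QbarIter L (j+2) U = 0}` — then `τ = 0` on `ker Sq`
is `NE7ExactCurrentQbarKernel.dAction_eq_zero_of_QbarIter_eq_zero` (structure theorem + gauge covariance + criticality of the interior minimiser) —
and `‖Sq − S′‖ ≤ δ`.  RESULT **`tension_energy_le_of_near_straightPart`**: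
  `Σ_{x∈periodBox (M·N)} Σ_ν nhsNormSq (T_ν(x)) ≤ 13·‖S′T̃‖²∕λ′ + (7(Λ′+δ)²∕λ′ + 4)·θ₀²`,
and with this generation's (β_S) (`NE7CombLineSumDivergence.sum_nhsNormSq_TWg_combFrame_tension_le`, `‖B‖ ≤ 2a`) **`tension_energy_le_end`**:
  `… ≤ 13·(N^d·d·(4d·M^d·a·(1+(d+1)(M−1)Ma))²)∕λ′ + (7(Λ′+δ)²∕λ′ + 4)·θ₀²` — with `a = ε′M^{−2}`: `O(d³ε′²·N^d·M^{d−6}) + O(ε′⁴·N^d·M^{d−8}·…)`, the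
currency and order of (H∃)ᵀ (`NE7EtaBackgroundTensionClass.hminE_of_tension`).
WHAT `Sq` IS TO BE (the one located residual of the road, NAMED): `M^d•Ad(cavgIter L (j+2) U ·)∘QbarIter L (j+2) U` packaged on `K_f` (additivity
`NE3CovariantLineSumsTower.QbarIter_add`, skewness `Qbar_skew`), whose distance to the comb line sum is the NE3 C1 tower
(`NE3CombVsTowerEnd.sum_norm_TWc_sub_Ad_QstrIter_sq_le` + `NE3CovariantLineSumsL2TowerSharp.sqrt_l2sq_ErrIter_le_sharp`, relative size
`(16d+20)·loopRad + 2·KS·radSum∕ρ`, to be made `≤ 1∕(8√3)` by the class smallness).  INTERIORITY (8) (`a < ε(L^{j+2})^{−2}`) stays a hypothesis.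
HONEST FRAMING (page 1): assembly of accepted tree theorems at ONE interior constrained minimiser on a FIXED FINITE torus, rung (B)+1; CONDITIONAL on
the operator `Sq` and on interiority; NE7, NE3 NOT PRINTED in [Balaban1984PropagatorsI]–[Balaban1989LargeFieldII] and NOT PROVED; continuum YM on
T⁴ ⇐ BetaPertH ∧ nine spine estimates (0/9 proved); BetaPertH ⇐ (D1) ∧ (D4) ∧ CAP+tail; G-an2-4 gates asym, D1 and NE2/3/4; NOT infinite volume, NOT
mass gap, NOT Clay.  0 def, 0 sorry.
-/

set_option autoImplicit false

open scoped BigOperators InnerProductSpace Matrix Matrix.Norms.L2Operator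
open Finset

namespace Summit.QuantumFields.BalabanUV.T4Continuum.NE7TensionEnergyEnd

open Literature.MathematicalPhysics.QuantumFieldTheory.Balaban1983to89
open B7Prop1Explicit B7Prop2Explicit MatrixNorms UnitaryModel
open T4AveragingDeficitWall (IsUnitaryCfg IsSkewDir SmallField Ad flux)
open T4AveragingDeficitWallBoundary (periodBox IsPeriodicCfg)
open AveragingDeficitPeriodicCounting (IsPeriodicDir)
open AveragingDeficitMultiLevelPrep (LevelSmall)
open MinimalActionSandwich (IsMinimiser)
open MinimalActionRate (sfClass)
open NE3HessShapes (plaqsOf)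
open NE3HessForm (dAction)
open NE3TangentCovariantTower (QbarIter)
open NE3CovariantCalculus (hsR cDstar)
open NE3CovariantWeitzenbock (frame)
open NE3CovariantLineAdjoint
open NE3HilbertSchmidtTorus
open NE7TensionKernelCoercivity (inner_resF_tension norm_sq_resF_tension)
open NE7ExactCurrent (exists_exactCurrent exactCurrent_sub_tension_pairing_le)
open NE7ExactCurrentQbarKernel (dAction_eq_zero_of_QbarIter_eq_zero)
open NE7CombLineSumCoercive (combLineSum_adjoint_lower combLineSum_adjoint_upper)
open NE7RestrictedOperator (norm_restrict_apply adjoint_restrict_lower adjoint_restrict_upper)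
open NE7SkewTorusForms (resF_tensionDatum_mem adjoint_combLineSum_mem fluxForm_skew)
open NE7TensionKernelPerturbed (normSq_le_of_exact_annihilator_near)
open NE7CombLineSumDivergence (sum_nhsNormSq_TWg_combFrame_tension_le)
open NE7FluxGradientFromTension (norm_fluxForm_le fluxForm_periodic)

noncomputable section

variable {d : ℕ} {n : Type*} [Fintype n] [DecidableEq n]

/-! ## §1 The tension energy of an interior constrained minimiser, modulo a `δ`-close operator with kernel in `ker QbarIter` -/

/-- **THE ENERGY ROAD, ASSEMBLED.**  `U` an interior `(j+2)`-level constrained minimiser of `sfClass d L N ε` (`L, N ≥ 1`, `SmallField U a`,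
`0 ≤ a ≤ 1∕4`, `a < ε∕(L^{j+2})²`, `LevelSmall d L (j+1) (ε∕(L^{j+2})²)`), `B` its flux form, `M = L^{j+2}`; `K_f`, `K_c` the skew torus 1-forms of
periods `M·N`, `N`; `S′` the comb line sum CLM and `S′_r` its restriction to `K_f → K_c`; `Sq : K_f →L K_c` ANY operator with `Sq b = 0 ⇒
QbarIter L (j+2) U (extF b) = 0` and `‖Sq − S′_r‖ ≤ δ`, `8δ ≤ √λ′`, `λ′ = M^{d−1}·M(M²+2)∕3`.  Then, with `Λ′ = √(M^{d−1}M³)`,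
`θ₀ = 12·#Plane·a²·√(d·(MN)^d·card n)` and `T̃` the `resF` tension datum:
`Σ_{x∈periodBox (M·N)} Σ_ν nhsNormSq (Σ_μ cDstar U μ B_{·μν}(x)) ≤ 13·‖S′ T̃‖²∕λ′ + (7(Λ′+δ)²∕λ′ + 4)·θ₀²`. [folklore] -/
theorem tension_energy_le_of_near_straightPart [Nonempty n] {L N : ℕ} (hL : 1 ≤ L) (hN : 1 ≤ N) {ε a : ℝ} (j : ℕ)
    {V U : Site d → Fin d → (Matrix n n ℂ)ˣ} (hmin : IsMinimiser d (sfClass d L N ε) L N (j + 2) V U)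
    (ha0 : 0 ≤ a) (ha4 : a ≤ 1 / 4) (haε : a < ε / ((L : ℝ) ^ (j + 2)) ^ 2) (hUa : SmallField U a)
    (hls : LevelSmall d L (j + 1) (ε / ((L : ℝ) ^ (j + 2)) ^ 2))
    {B : Site d → Fin d → Fin d → Matrix n n ℂ} (hBF : ∀ (x : Site d) (μ ν : Fin d) (h : μ < ν), B x μ ν = flux U (x, ⟨(μ, ν), h⟩))
    (hanti : ∀ (x : Site d) (μ ν : Fin d), B x ν μ = -B x μ ν)
    [NeZero N] [NeZero (L ^ (j + 2) * N)]
    {Kf : Submodule ℝ (Form d n (L ^ (j + 2) * N))} (hKf : ∀ b : Form d n (L ^ (j + 2) * N), b ∈ Kf ↔ IsSkewDir (extF (L ^ (j + 2) * N) b))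
    {Kc : Submodule ℝ (Form d n N)} (hKc : ∀ b : Form d n N, b ∈ Kc ↔ IsSkewDir (extF N b))
    (S' : Form d n (L ^ (j + 2) * N) →L[ℝ] Form d n N)
    (hS' : ∀ η, S' η = resF N (TWg (L ^ (j + 2)) (combFrame U (L ^ (j + 2))) (extF (L ^ (j + 2) * N) η)))
    (S'r : Kf →L[ℝ] Kc) (hS'r : ∀ x : Kf, (S'r x : Form d n N) = S' (x : Form d n (L ^ (j + 2) * N)))
    (Sq : Kf →L[ℝ] Kc)
    (hSq : ∀ b : Kf, Sq b = 0 → ∀ (z : Site d) (κ : Fin d), QbarIter L (j + 2) U (extF (L ^ (j + 2) * N) (b : Form d n (L ^ (j + 2) * N))) z κ = 0)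
    {δ : ℝ} (hδ0 : 0 ≤ δ) (hδ : 8 * δ ≤ Real.sqrt (((L ^ (j + 2) : ℕ) : ℝ) ^ (d - 1) * (((L ^ (j + 2) : ℕ) : ℝ) * (((L ^ (j + 2) : ℕ) : ℝ) ^ 2 + 2) / 3)))
    (hSqS' : ‖Sq - S'r‖ ≤ δ) :
    ∑ x ∈ periodBox (d := d) (L ^ (j + 2) * N), ∑ ν : Fin d, nhsNormSq (∑ μ : Fin d, cDstar U μ (fun y => B y μ ν) x)
      ≤ 13 * ‖S' (resF (d := d) (L ^ (j + 2) * N) (fun x ν => Ad (U x ν)⁻¹ (∑ μ : Fin d, cDstar U μ (fun y => B y μ ν) x)))‖ ^ 2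
            / (((L ^ (j + 2) : ℕ) : ℝ) ^ (d - 1) * (((L ^ (j + 2) : ℕ) : ℝ) * (((L ^ (j + 2) : ℕ) : ℝ) ^ 2 + 2) / 3))
        + (7 * (Real.sqrt (((L ^ (j + 2) : ℕ) : ℝ) ^ (d - 1) * ((L ^ (j + 2) : ℕ) : ℝ) ^ 3) + δ) ^ 2
              / (((L ^ (j + 2) : ℕ) : ℝ) ^ (d - 1) * (((L ^ (j + 2) : ℕ) : ℝ) * (((L ^ (j + 2) : ℕ) : ℝ) ^ 2 + 2) / 3)) + 4)
          * (12 * (Fintype.card (T4AveragingDeficitWall.Plane d) : ℝ) * a ^ 2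
              * Real.sqrt (d * (((L ^ (j + 2) * N : ℕ) : ℕ) : ℝ) ^ d * Fintype.card n)) ^ 2 := by
  haveI : CompleteSpace (Form d n (L ^ (j + 2) * N)) := FiniteDimensional.complete ℝ _
  haveI : CompleteSpace (Form d n N) := FiniteDimensional.complete ℝ _
  haveI : CompleteSpace Kf := FiniteDimensional.complete ℝ _
  haveI : CompleteSpace Kc := FiniteDimensional.complete ℝ _
  have hM : 1 ≤ L ^ (j + 2) := Nat.one_le_pow _ _ hL
  have hU : IsUnitaryCfg U := hmin.mem.1.1
  have hUP : IsPeriodicCfg U ((L ^ (j + 2) * N : ℕ) : ℤ) := by rw [Nat.mul_comm]; exact hmin.mem.1.2.1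
  have hM0 : (0 : ℝ) < ((L ^ (j + 2) : ℕ) : ℝ) := by exact_mod_cast hM
  have hlam'pos : 0 < (((L ^ (j + 2) : ℕ) : ℝ) ^ (d - 1) * (((L ^ (j + 2) : ℕ) : ℝ) * (((L ^ (j + 2) : ℕ) : ℝ) ^ 2 + 2) / 3)) := by
    positivity
  have hθ₀0 : 0 ≤ 12 * (Fintype.card (T4AveragingDeficitWall.Plane d) : ℝ) * a ^ 2
      * Real.sqrt (d * (((L ^ (j + 2) * N : ℕ) : ℕ) : ℝ) ^ d * Fintype.card n) := by positivity
  -- the tension datum as a vector of `K_f`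
  have hBs : ∀ x μ ν, B x μ ν ∈ skewAdjoint (Matrix n n ℂ) := fluxForm_skew hU ha4 hUa hBF hanti
  have hTmem : resF (d := d) (L ^ (j + 2) * N) (fun x ν => Ad (U x ν)⁻¹ (∑ μ : Fin d, cDstar U μ (fun y => B y μ ν) x)) ∈ Kf :=
    resF_tensionDatum_mem hKf hU hBs
  -- the exact current, restricted to the skew forms
  obtain ⟨τ, hτ⟩ := exists_exactCurrent U (L ^ (j + 2) * N) (plaqsOf (periodBox (d := d) (L ^ (j + 2) * N)))
  have hτK_apply : ∀ ψ : Kf, (τ.comp Kf.subtypeL) ψ = τ (ψ : Form d n (L ^ (j + 2) * N)) := fun ψ => rfl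
  -- (E3‴) on `K_f → K_c`
  have hmain := normSq_le_of_exact_annihilator_near (E := Kf) (F := Kc) Sq S'r (τ.comp Kf.subtypeL) ⊤
    (T := ⟨_, hTmem⟩) Submodule.mem_top hθ₀0 hlam'pos (Real.sqrt_nonneg (((L ^ (j + 2) : ℕ) : ℝ) ^ (d - 1) * ((L ^ (j + 2) : ℕ) : ℝ) ^ 3))
    hδ0 hδ ?hτS ?hSK ?hτT ?hlow ?hup hSqS'
  case hτS =>
    intro ψ hψ
    rw [hτK_apply, hτ]
    have hP : periodBox (d := d) (L ^ (j + 2) * N) = periodBox (N * L ^ (j + 2)) := by rw [Nat.mul_comm]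
    rw [hP]
    have hψs : IsSkewDir (extF (L ^ (j + 2) * N) (ψ : Form d n (L ^ (j + 2) * N))) := (hKf _).mp ψ.2
    have hψP : IsPeriodicDir (extF (L ^ (j + 2) * N) (ψ : Form d n (L ^ (j + 2) * N))) ((N * L ^ (j + 2) : ℕ) : ℤ) := by
      have e : ((N * L ^ (j + 2) : ℕ) : ℤ) = ((L ^ (j + 2) * N : ℕ) : ℤ) := by rw [Nat.mul_comm]
      rw [e]; exact isPeriodicDir_extF (L ^ (j + 2) * N) _
    exact dAction_eq_zero_of_QbarIter_eq_zero hL hN j hmin ha0 haε hUa hls hψs hψP (hSq ψ hψ)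
  case hSK =>
    intro ψ₁ _ ψ₂ hψ₂ h
    rw [Submodule.top_orthogonal_eq_bot, Submodule.mem_bot] at hψ₂
    rwa [hψ₂, add_zero] at h
  case hτT =>
    intro ψ _
    have hinner : ⟪ψ, (⟨_, hTmem⟩ : Kf)⟫_ℝ = ∑ x ∈ periodBox (d := d) (L ^ (j + 2) * N), ∑ ν : Fin d,
        hsR (frame U (extF (L ^ (j + 2) * N) (ψ : Form d n (L ^ (j + 2) * N))) x ν) (∑ μ : Fin d, cDstar U μ (fun y => B y μ ν) x) := by
      rw [Submodule.coe_inner]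
      exact inner_resF_tension hU B _
    have hnorm : ‖ψ‖ = ‖(ψ : Form d n (L ^ (j + 2) * N))‖ := rfl
    rw [hτK_apply, hinner, hnorm]
    exact exactCurrent_sub_tension_pairing_le hU hUP ha0 ha4 hUa hBF hanti hτ ((hKf _).mp ψ.2)
  case hlow =>
    exact adjoint_restrict_lower hS'r (adjoint_combLineSum_mem hM hN hU hUP hKf hKc S' hS')
      (fun y _ => combLineSum_adjoint_lower hM hN hU hUP S' hS' y)
  case hup =>
    refine adjoint_restrict_upper hS'r (adjoint_combLineSum_mem hM hN hU hUP hKf hKc S' hS') (fun y _ => ?_)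
    rw [Real.sq_sqrt (by positivity)]
    exact combLineSum_adjoint_upper hM hN hU hUP S' hS' y
  -- read the conclusion in the lattice currency
  have hTnorm : ‖(⟨_, hTmem⟩ : Kf)‖ ^ 2
      = ∑ x ∈ periodBox (d := d) (L ^ (j + 2) * N), ∑ ν : Fin d, nhsNormSq (∑ μ : Fin d, cDstar U μ (fun y => B y μ ν) x) := by
    rw [show ‖(⟨_, hTmem⟩ : Kf)‖ = ‖resF (d := d) (L ^ (j + 2) * N)
      (fun x ν => Ad (U x ν)⁻¹ (∑ μ : Fin d, cDstar U μ (fun y => B y μ ν) x))‖ from rfl]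
    exact norm_sq_resF_tension hU B
  rw [hTnorm, norm_restrict_apply hS'r] at hmain
  exact hmain

/-! ## §2 With (β_S): the end in the currency of (H∃)ᵀ -/

/-- **THE END, WITH (β_S) INSERTED**: under the hypotheses of §1,
`Σ_{x∈periodBox (M·N)} Σ_ν nhsNormSq (T_ν(x)) ≤ 13·(N^d·d·(4d·M^d·a·(1+(d+1)(M−1)M a))²)∕λ′ + (7(Λ′+δ)²∕λ′ + 4)·θ₀²` — the comb line sum of the
tension datum bounded by `NE7CombLineSumDivergence` with `‖B‖ ≤ 2a` (`norm_fluxForm_le`).  With `a = ε′M^{−2}` both terms are of the order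
`N^d·M^d·M^{−6}` or better — the currency of (H∃)ᵀ. [folklore] -/
theorem tension_energy_le_end [Nonempty n] {L N : ℕ} (hL : 1 ≤ L) (hN : 1 ≤ N) {ε a : ℝ} (j : ℕ)
    {V U : Site d → Fin d → (Matrix n n ℂ)ˣ} (hmin : IsMinimiser d (sfClass d L N ε) L N (j + 2) V U)
    (ha0 : 0 ≤ a) (ha4 : a ≤ 1 / 4) (haε : a < ε / ((L : ℝ) ^ (j + 2)) ^ 2) (hUa : SmallField U a)
    (hls : LevelSmall d L (j + 1) (ε / ((L : ℝ) ^ (j + 2)) ^ 2))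
    {B : Site d → Fin d → Fin d → Matrix n n ℂ} (hBF : ∀ (x : Site d) (μ ν : Fin d) (h : μ < ν), B x μ ν = flux U (x, ⟨(μ, ν), h⟩))
    (hanti : ∀ (x : Site d) (μ ν : Fin d), B x ν μ = -B x μ ν)
    [NeZero N] [NeZero (L ^ (j + 2) * N)]
    {Kf : Submodule ℝ (Form d n (L ^ (j + 2) * N))} (hKf : ∀ b : Form d n (L ^ (j + 2) * N), b ∈ Kf ↔ IsSkewDir (extF (L ^ (j + 2) * N) b))
    {Kc : Submodule ℝ (Form d n N)} (hKc : ∀ b : Form d n N, b ∈ Kc ↔ IsSkewDir (extF N b))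
    (S' : Form d n (L ^ (j + 2) * N) →L[ℝ] Form d n N)
    (hS' : ∀ η, S' η = resF N (TWg (L ^ (j + 2)) (combFrame U (L ^ (j + 2))) (extF (L ^ (j + 2) * N) η)))
    (S'r : Kf →L[ℝ] Kc) (hS'r : ∀ x : Kf, (S'r x : Form d n N) = S' (x : Form d n (L ^ (j + 2) * N)))
    (Sq : Kf →L[ℝ] Kc)
    (hSq : ∀ b : Kf, Sq b = 0 → ∀ (z : Site d) (κ : Fin d), QbarIter L (j + 2) U (extF (L ^ (j + 2) * N) (b : Form d n (L ^ (j + 2) * N))) z κ = 0)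
    {δ : ℝ} (hδ0 : 0 ≤ δ) (hδ : 8 * δ ≤ Real.sqrt (((L ^ (j + 2) : ℕ) : ℝ) ^ (d - 1) * (((L ^ (j + 2) : ℕ) : ℝ) * (((L ^ (j + 2) : ℕ) : ℝ) ^ 2 + 2) / 3)))
    (hSqS' : ‖Sq - S'r‖ ≤ δ) :
    ∑ x ∈ periodBox (d := d) (L ^ (j + 2) * N), ∑ ν : Fin d, nhsNormSq (∑ μ : Fin d, cDstar U μ (fun y => B y μ ν) x)
      ≤ 13 * ((N : ℝ) ^ d * d * (2 * d * ((L ^ (j + 2) : ℕ) : ℝ) ^ d * (2 * a)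
                * (1 + ((d : ℝ) + 1) * (((L ^ (j + 2) : ℕ) : ℝ) - 1) * ((L ^ (j + 2) : ℕ) : ℝ) * a)) ^ 2)
            / (((L ^ (j + 2) : ℕ) : ℝ) ^ (d - 1) * (((L ^ (j + 2) : ℕ) : ℝ) * (((L ^ (j + 2) : ℕ) : ℝ) ^ 2 + 2) / 3))
        + (7 * (Real.sqrt (((L ^ (j + 2) : ℕ) : ℝ) ^ (d - 1) * ((L ^ (j + 2) : ℕ) : ℝ) ^ 3) + δ) ^ 2
              / (((L ^ (j + 2) : ℕ) : ℝ) ^ (d - 1) * (((L ^ (j + 2) : ℕ) : ℝ) * (((L ^ (j + 2) : ℕ) : ℝ) ^ 2 + 2) / 3)) + 4)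
          * (12 * (Fintype.card (T4AveragingDeficitWall.Plane d) : ℝ) * a ^ 2
              * Real.sqrt (d * (((L ^ (j + 2) * N : ℕ) : ℕ) : ℝ) ^ d * Fintype.card n)) ^ 2 := by
  have h := tension_energy_le_of_near_straightPart hL hN j hmin ha0 ha4 haε hUa hls hBF hanti hKf hKc S' hS' S'r hS'r Sq hSq hδ0 hδ hSqS'
  refine h.trans (add_le_add ?_ le_rfl)
  -- `‖S′ T̃‖² ≤ N^d·d·(…)²`
  have hM : 1 ≤ L ^ (j + 2) := Nat.one_le_pow _ _ hL
  have hU : IsUnitaryCfg U := hmin.mem.1.1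
  have hUP : IsPeriodicCfg U ((L ^ (j + 2) * N : ℕ) : ℤ) := by rw [Nat.mul_comm]; exact hmin.mem.1.2.1
  have hM0 : (0 : ℝ) < ((L ^ (j + 2) : ℕ) : ℝ) := by exact_mod_cast hM
  have hlam'pos : 0 < (((L ^ (j + 2) : ℕ) : ℝ) ^ (d - 1) * (((L ^ (j + 2) : ℕ) : ℝ) * (((L ^ (j + 2) : ℕ) : ℝ) ^ 2 + 2) / 3)) := by
    positivity
  refine div_le_div_of_nonneg_right (mul_le_mul_of_nonneg_left ?_ (by norm_num)) hlam'pos.le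
  -- the datum is periodic, so `extF (resF T̃) = T̃`
  have hTper : IsPeriodicDir (fun x ν => Ad (U x ν)⁻¹ (∑ μ : Fin d, cDstar U μ (fun y => B y μ ν) x)) ((L ^ (j + 2) * N : ℕ) : ℤ) := by
    intro x τ' ν
    have hBper : ∀ (y : Site d) (κ μ' ν' : Fin d), B (y + ((L ^ (j + 2) * N : ℕ) : ℤ) • e κ) μ' ν' = B y μ' ν' :=
      fun y κ μ' ν' => fluxForm_periodic hUP hBF hanti y κ μ' ν'
    show Ad (U (x + _ • e τ') ν)⁻¹ _ = Ad (U x ν)⁻¹ _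
    rw [hUP x τ' ν]
    congr 1
    refine Finset.sum_congr rfl fun μ _ => ?_
    exact NE3CovariantCalculus.cDstar_periodic hUP μ (fun y κ => hBper y κ μ ν) x τ'
  rw [hS', extF_resF (L ^ (j + 2) * N) hTper, norm_sq_resF]
  exact sum_nhsNormSq_TWg_combFrame_tension_le hM hU ha0 hUa B
    (fun x μ ν => norm_fluxForm_le ha0 (by linarith) hUa hBF hanti x μ ν) N

end

end Summit.QuantumFields.BalabanUV.T4Continuum.NE7TensionEnergyEnd
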